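/-
Copyright: lit-balaban cell, Phase-2 proof seat p24 (gen 26).  Released under Apache 2.0 license as described in the
file LICENSE.
-/
import Literature.MathematicalPhysics.QuantumFieldTheory.Balaban1983to89.B4Lemma22ZeroLatticeLpSchur
import Literature.MathematicalPhysics.QuantumFieldTheory.Balaban1983to89.B4Eq16ZeroLatticeL2Operator

/-!
# `Balaban1983to89.B4Eq246ZeroLatticeL1` — [Balaban1983RegularityDecay] (2.44)–(2.46): `G_k(0) = G_j` ON ALL OF `ℓ¹(ξℤ^{d+1})`,
# AND LEMMA 2.2 (2.17) FOR THE FOURIER-BUILT PROPAGATOR `G_j` OF (2.46) ITSELF ON THAT DOMAIN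

statement-level skeleton of published theorems with citation tags; proofs where landed; nothing here is a claim about
the Yang–Mills mass gap

CITATION HEADER.  T. Bałaban, *Regularity and decay of lattice Green's functions*, Commun. Math. Phys. **89** (1983)
571–597, doi:10.1007/bf01214744 [Balaban1983RegularityDecay] (cell paper B4; held text
`paper:balaban1983-cmp89-regularity-decay`, journal page = PDF page + 570): p. 578 [PDF 8] Lemma 2.2 (2.17), p. 583
[PDF 13] its proof and (2.41), p. 584 [PDF 14] (2.43)–(2.46); T. Bałaban, *(Higgs)₂,₃ quantum fields in a finite volume.
III. Renormalization*, Commun. Math. Phys. **88** (1983) 411–445 [Balaban1983Higgs3], p. 433 [PDF 23] («G_k(0)»).  Unit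
`lit-balaban-p24` gen 26 (free target under HOME/STATUS G.5-34 (d), TAKING line #3 2026-08-25T03:19Z; cc r01 = B4 row
owner); HOME `run/shared/lean/pub/lit-balaban/`; SKELETON rows **B4.Eq2.43** ((2.43)–(2.48)), **B4.Lem2.2**, **B4.Eq1.6**
(owner r01) — cells only, all proved-headed, heads unchanged.  Completes the dictionary «G_k(0) of [B3] p. 433 = G_j of [B4]
(2.46)» of `B4Thm110ZeroLattice` (p24 g25: columns `GkLat_col_eq_G246`, finitely supported data `GkLat_apply_eq_G246`) to the
NATURAL DOMAIN of the (2.43) transform — all summable data (`B4Eq243TransformSummable.ftSum`, p24 g23) — and transports the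
whole-lattice Lemma 2.2 of `B4Lemma22ZeroLatticeLpSchur` ∕ `B4Lemma22ZeroLatticeLpOperators` (p24 g26) to `G_j`.  Builds on
those two files and `B4Eq16ZeroLatticeL2Operator` (p24 g25), read-only.

WHAT IS PRINTED.  [B4] p. 584 (held text p0014): «We represent G_j(□) with the help of the propagator G_j with free
boundary conditions on ξZ^d using the multiple reflection method. … Now we will construct an explicit representation for
G_j. Let us introduce a Fourier transform on ξZ^d by the formulas f̃(p) = Σ_x ξ^d e^{−ip·x} f(x),
f(x) = (2π)^{−d} ∫_{|p|≤π/ξ} e^{ix·p} f̃(p). (2.43) We apply it to the basic equation (−Δ^ξ + m_j² + a_jQ_j^*Q_j)φ₀ = f. (2.44)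
Defining the propagator G_j, φ₀ = G_jf, we get [(2.45), solved by (2.46)]».  pp. 577–578 (p0007–p0008),
Lemma 2.2: «… and a constant c₂ depending on d, p₁, such that ‖G_k(□,Ã)f‖_q, ‖D^η_{Ã,μ}G_k(□,Ã)f‖_q, ‖G_k(□,Ã)D^{η*}_{Ã,μ}f‖_q
≦ c₂‖f‖_p (2.17) for 1 ≦ p, q ≦ ∞, satisfying the condition 1/p − 1/p₁ ≦ 1/q ≦ 1/p with p₁ > d.»; p. 583 (p0013): «For
q = p = 1 we get it by duality argument … The Riesz-Thorin Theorem implies it for arbitrary q = p from [1, ∞]. … Now we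
will prove that the operators G_k(□), ∂^η_μG_k(□), G_k(□)∂^{η*}_μ are bounded operators from L^{p₁}(□) with p₁ > d to
L^∞(□) … (2.41)».  [B3] p. 433: «we substitute G_k(□,0) = G_k(0) + δG_k(□,ηZ^d,0)».

WHAT THIS MODULE PROVES (kernel-checked; theorems only; 0 `def`; 0 `sorry`; axioms standard).  Throughout `L = ℓ + 1 ≥ 2`,
`k ≥ 1`, `n = L^k` fine points per unit block (`ξ = L^{−k}` in unit-block units), `G_k(0) = B3GkZeroLattice.GkLat ℓ k a m²`
(the thermodynamic limit of the Neumann-cube kernels, running coefficient `a_k = B1.aSeq a L k`), `G_j = G246 n a m²` (the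
Fourier-built solution operator of (2.44), `B4Eq246SolvesEq244`, literal coefficient `a`), `c_k = B4Thm110ZeroBox.cK ℓ k`
(`B1.aSeq (a/c_k) L k = a`, `aSeq_div_cK`), mass `m² > 0` (where (2.46) is a convergent integral).
* §1 **`G_k(0) = G_j` ON `ℓ¹(ξℤ^{d+1}, ℂ)`** (`GkLat_apply_eq_G246_of_summable`, literal-coefficient form
  `GkLat_apply_eq_G246_literal`, pointwise `G246_apply_eq_tsum`): for EVERY summable `f : ℤ^{d+1} → ℂ`,
  `x ↦ Σ_z G_k(0)(x,z)f(z)` (absolutely convergent) IS `G246 n a_k m² f` — both are THE square-summable solution of (2.44)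
  (`B4Eq16ZeroLatticeL2Operator.GkLat_inverse_l2`, `ℓ¹ ⊂ ℓ²`, and `B4Eq246SquareSummable.G246_eq_of_solution_l2`).
* §2 **LEMMA 2.2 (2.17) FOR `G_j` ON ITS NATURAL DOMAIN** (window-uniform constants on `d`, `L`, `[a₋,a₊]`, `]0,m²₊]`):
  `G246_apply_lp_le_of_summable` — the diagonal `q = p ∈ [1,∞[` for all complex `f ∈ ℓ¹`:
  `(Σ_x‖(G_jf)(x)‖^p)^{1/p} ≤ c₀(Σ_z‖f(z)‖^p)^{1/p}` (Schur constant, free of `p₁`; from `B4Lemma22ZeroLatticeLpSchur`);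
  `G246_lpq_le_of_summable_real` — the `η`-weighted parallelogram `1 ≤ p ≤ q < ∞`, `1/p − 1/p₁ ≤ 1/q`, `p₁ > d + 1`, for all
  real `f ∈ ℓ¹`: `(η^{d+1}Σ_x|(G_jf)(x)|^{1/t})^t ≤ c₂(η^{d+1}Σ_z|f(z)|^{1/s})^s`, `s = 1/p`, `t = 1/q` (from
  `B4Lemma22ZeroLatticeLpOperators`); `G246_sup_lp_le_of_summable_real` — (2.41), `q = ∞`, `p ≥ p₁`:
  `|(G_jf)(x)| ≤ c₂(η^{d+1}Σ_z|f(z)|^{1/s})^s`.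
* §3 Non-vacuity at `d + 1 = 4`, `L = 2`: the identification for a summable datum of INFINITE support.

DICTIONARY / HONEST SCOPE.  (i) `A = 0`, one component, the whole lattice (no boundary); `m² > 0` (the tree's theorems on
`G246` — `B4Eq246SolvesEq244.opD_G246`, `B4Eq246SquareSummable.G246_eq_of_solution_l2` — assume it: at `m² = 0` the
integrand of (2.46) is singular at `p = 0`; `G_k(0)` itself is fine there, see `B4Eq16ZeroLatticeL2Operator`).
(ii) `G_j = G246` is stated on summable data only — the domain of the lattice Fourier transform (2.43)₁ as an absolutely
convergent sum; on `ℓ^p ∖ ℓ¹`, `p > 1`, the operator of record is the kernel `G_k(0)`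
(`B4Lemma22ZeroLatticeLpOperators` ∕ `…LpSchur`).  Since `ℓ¹ ⊂ ℓ^p`, every (2.17) bound is available on that domain; the
right-hand sides are the `ℓ^p` norms of `f` (finite).  (iii) Off the diagonal the data are real (`f ↦ (f : ℂ)`), as in
`B4Lemma22ZeroLatticeLpOperators`; complex data on the diagonal.  (iv) Dimension `d + 1 ≥ 1` written `Fin (d + 1) → ℤ`;
`p₁ > d + 1` is print's «p₁ > d» in print's dimension `d` (here `d + 1`).  (v) Value = the identification of the two
whole-lattice free propagators of the lineage on the natural common domain and Lemma 2.2 for the Fourier-built one; cells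
only; NOT summit progress.  (vi) OWNER READING (r01 g52, said once): `ℓ¹` is the natural domain of the (2.43) transform, and §1 is a DOMAIN
EXTENSION of `B4Thm110ZeroLattice.GkLat_apply_eq_G246` by `ℓ¹ ⊂ ℓ²` + uniqueness of the `ℓ²` inverse — within print ((2.46)
«Defining the propagator G_j, φ₀ = G_jf» is stated for the `f` for which the transform makes sense), no new constant; §2 is
(2.17) for `G_k(0)` as already landed (`B4Lemma22ZeroLatticeLpLq` p382730, `B4Lemma22ZeroLatticeLpOperators` p388785,
`B4Lemma22ZeroLatticeLpSchur` p389953) transported along that identity.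
-/

namespace Literature.MathematicalPhysics.QuantumFieldTheory.Balaban1983to89.B4Eq246ZeroLatticeL1

open Finset Filter Topology
open Literature.Analysis.FunctionSpaces.Torus (summable_norm_sq_of_summable_norm)
open Literature.MathematicalPhysics.QuantumFieldTheory.Balaban1983to89.B3GkZeroLattice (GkLat)
open Literature.MathematicalPhysics.QuantumFieldTheory.Balaban1983to89.B4Thm110ZeroBox (Linv_sq_bounds cK cK_pos cK_le_one
  oneSub_le_cK aSeq_div_cK one_lt_L_real)
open Literature.MathematicalPhysics.QuantumFieldTheory.Balaban1983to89.B4Eq246SolvesEq244 (G246)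
open Literature.MathematicalPhysics.QuantumFieldTheory.Balaban1983to89.B4Eq246SquareSummable (G246_eq_of_solution_l2)
open Literature.MathematicalPhysics.QuantumFieldTheory.Balaban1983to89.B4Green244 (opD)
open Literature.MathematicalPhysics.QuantumFieldTheory.Balaban1983to89.B4Eq16ZeroLatticeL2Operator (GkLat_inverse_l2)
open Literature.MathematicalPhysics.QuantumFieldTheory.Balaban1983to89.B4Lemma22ZeroLatticeLpSchur (GkLat_apply_lp_le_of_lp)
open Literature.MathematicalPhysics.QuantumFieldTheory.Balaban1983to89.B4Lemma22ZeroLatticeLpOperators (GkLat_lpq_le_of_lp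
  GkLat_sup_lp_le_of_lp)

noncomputable section

variable {d : ℕ}

/-! ## §0 Kernel helpers: `ℓ¹ ⊂ ℓ^p` for `p ≥ 1`; the coefficient window `a ↦ a/c_k` -/

/-- kernel: `Σ‖f‖ < ∞ ⇒ Σ‖f‖^p < ∞` for real `p ≥ 1` (eventually `‖f(z)‖ ≤ 1`, where `‖f(z)‖^p ≤ ‖f(z)‖`). [folklore] -/
private theorem summable_norm_rpow_of_summable_norm {X E : Type*} [SeminormedAddCommGroup E] {f : X → E}
    (hf : Summable fun z => ‖f z‖) {p : ℝ} (hp : 1 ≤ p) : Summable fun z => ‖f z‖ ^ p := by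
  refine Summable.of_norm_bounded_eventually hf ?_
  filter_upwards [hf.tendsto_cofinite_zero.eventually (eventually_le_nhds zero_lt_one)] with z hz
  rw [Real.norm_of_nonneg (Real.rpow_nonneg (norm_nonneg _) _)]
  calc ‖f z‖ ^ p ≤ ‖f z‖ ^ (1 : ℝ) := Real.rpow_le_rpow_of_exponent_ge' (norm_nonneg _) hz zero_le_one hp
    _ = ‖f z‖ := Real.rpow_one _

/-- kernel: the literal coefficient `a ∈ [a₋,a₊]` puts `a/c_k` in the window `[a₋, a₊/(1 − L^{−2})]`, and `a/c_k > 0`. [folklore] -/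
private theorem window_div_cK {ℓ k : ℕ} (hℓ : 1 ≤ ℓ) (hk : 1 ≤ k) {amin aplus a : ℝ} (ha : 0 < amin) (h1 : amin ≤ a)
    (h2 : a ≤ aplus) :
    0 < a / cK ℓ k ∧ amin ≤ a / cK ℓ k ∧ a / cK ℓ k ≤ aplus / (1 - ((((ℓ : ℝ) + 1)) ^ 2)⁻¹) := by
  obtain ⟨hr0, hr1⟩ := Linv_sq_bounds hℓ
  have hc := cK_pos hℓ hk
  have hA1 : amin ≤ a / cK ℓ k := by
    rw [le_div_iff₀ hc]
    calc amin * cK ℓ k ≤ amin * 1 := mul_le_mul_of_nonneg_left (cK_le_one hℓ hk) ha.le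
      _ ≤ a := by linarith
  exact ⟨ha.trans_le hA1, hA1, div_le_div₀ (by linarith) h2 (by linarith) (oneSub_le_cK hℓ hk)⟩

/-! ## §1 `G_k(0) = G_j` on all summable data -/

section Ident

variable {ℓ k : ℕ} {a m2 : ℝ}

/-- **`G_k(0)f = G_jf` FOR EVERY SUMMABLE `f`** (`m² > 0`; running coefficient `a_k` on both sides): for `f ∈ ℓ¹(ξℤ^{d+1}, ℂ)`
the absolutely convergent kernel series `x ↦ Σ_z G_k(0)(x,z)f(z)` of [B3] p. 433 equals the Fourier-built `G246 n a_k m² f`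
of (2.46) — «Defining the propagator G_j, φ₀ = G_jf»: both are square-summable solutions of the basic equation (2.44)
(`B4Eq16ZeroLatticeL2Operator.GkLat_inverse_l2` with `ℓ¹ ⊂ ℓ²`; `B4Eq246SolvesEq244.opD_G246`), and (2.44) has at most one
such solution (`B4Eq246SquareSummable.G246_eq_of_solution_l2`).  Extends `B4Thm110ZeroLattice.GkLat_apply_eq_G246`
(finitely supported `f`) to the natural domain of the transform (2.43)₁.
[cite: Balaban1983RegularityDecay, (2.43)–(2.46) p.584; Balaban1983Higgs3, p.433 («G_k(□,0) = G_k(0) + δG_k(□,ηZ^d,0)»); dictionary (A = 0, m² > 0, f ∈ ℓ¹)] -/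
theorem GkLat_apply_eq_G246_of_summable (hℓ : 1 ≤ ℓ) (hk : 1 ≤ k) (ha : 0 < a) (hm : 0 < m2)
    {f : (Fin (d + 1) → ℤ) → ℂ} (hf : Summable fun z => ‖f z‖) :
    (fun x => ∑' z, ((GkLat ℓ k a m2 x z : ℝ) : ℂ) * f z) = G246 ((ℓ + 1) ^ k) (B1.aSeq a ((ℓ : ℝ) + 1) k) m2 f := by
  haveI : NeZero ((ℓ + 1) ^ k) := ⟨pow_ne_zero _ (Nat.succ_ne_zero ℓ)⟩
  have hak : 0 < B1.aSeq a ((ℓ : ℝ) + 1) k := B1.aSeq_pos ha (one_lt_L_real hℓ) hk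
  obtain ⟨-, h2, -, h4, -⟩ := GkLat_inverse_l2 (d := d) hℓ hk ha hm.le (summable_norm_sq_of_summable_norm hf)
  exact G246_eq_of_solution_l2 ((ℓ + 1) ^ k) (Nat.succ_pos d) hak.le hm hf h2 h4

/-- **`G_k(0) = G_j` WITH THE LITERAL COEFFICIENT `a` OF (2.44)**: `Σ_z G_k(0)(x,z)f(z)` at the coefficient `a/c_k` (whose
running value is `(a/c_k)_k = a`, `B4Thm110ZeroBox.aSeq_div_cK`) equals `G246 n a m² f`, every summable `f`, `m² > 0`.
[cite: Balaban1983RegularityDecay, (2.44)–(2.46) p.584; dictionary (A = 0, m² > 0, f ∈ ℓ¹, a_k ↦ a)] -/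
theorem GkLat_apply_eq_G246_literal (hℓ : 1 ≤ ℓ) (hk : 1 ≤ k) (ha : 0 < a) (hm : 0 < m2)
    {f : (Fin (d + 1) → ℤ) → ℂ} (hf : Summable fun z => ‖f z‖) :
    (fun x => ∑' z, ((GkLat ℓ k (a / cK ℓ k) m2 x z : ℝ) : ℂ) * f z) = G246 ((ℓ + 1) ^ k) a m2 f := by
  have h := GkLat_apply_eq_G246_of_summable (d := d) hℓ hk (div_pos ha (cK_pos hℓ hk)) hm hf
  rwa [aSeq_div_cK hℓ hk] at h

/-- **(2.46) IN POSITION SPACE, POINTWISE**: `(G_jf)(x) = Σ_z G_k(0)(x,z)f(z)` (coefficient `a/c_k` in `G_k(0)`), every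
summable `f`, every `x`. [cite: Balaban1983RegularityDecay, (2.46) p.584; Balaban1983Higgs3, p.433; dictionary (A = 0, m² > 0, f ∈ ℓ¹)] -/
theorem G246_apply_eq_tsum (hℓ : 1 ≤ ℓ) (hk : 1 ≤ k) (ha : 0 < a) (hm : 0 < m2)
    {f : (Fin (d + 1) → ℤ) → ℂ} (hf : Summable fun z => ‖f z‖) (x : Fin (d + 1) → ℤ) :
    G246 ((ℓ + 1) ^ k) a m2 f x = ∑' z, ((GkLat ℓ k (a / cK ℓ k) m2 x z : ℝ) : ℂ) * f z :=
  congrFun (GkLat_apply_eq_G246_literal hℓ hk ha hm hf).symm x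

/-- **REAL DATA**: for summable real `f`, `(G_jf)(x)` is the real number `Σ_z G_k(0)(x,z)f(z)` (coefficient `a/c_k`), so
`‖(G_jf)(x)‖ = |Σ_z G_k(0)(x,z)f(z)|`. [cite: Balaban1983RegularityDecay, (2.46) p.584; dictionary (A = 0, m² > 0, real f ∈ ℓ¹)] -/
theorem norm_G246_apply_real (hℓ : 1 ≤ ℓ) (hk : 1 ≤ k) (ha : 0 < a) (hm : 0 < m2)
    {f : (Fin (d + 1) → ℤ) → ℝ} (hf : Summable fun z => |f z|) (x : Fin (d + 1) → ℤ) :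
    ‖G246 ((ℓ + 1) ^ k) a m2 (fun z => (f z : ℂ)) x‖ = |∑' z, GkLat ℓ k (a / cK ℓ k) m2 x z * f z| := by
  have hfC : Summable fun z => ‖((f z : ℝ) : ℂ)‖ := hf.congr fun z => by rw [Complex.norm_real, Real.norm_eq_abs]
  rw [G246_apply_eq_tsum hℓ hk ha hm hfC x]
  simp_rw [← Complex.ofReal_mul]
  rw [← Complex.ofReal_tsum, Complex.norm_real, Real.norm_eq_abs]

end Ident

/-! ## §2 Lemma 2.2 (2.17) for `G_j` on its natural domain -/

/-- **LEMMA 2.2 (2.17) ON THE DIAGONAL `q = p ∈ [1,∞[` FOR THE PROPAGATOR `G_j` OF (2.46)**: there is `c₀ > 0` (on `d`, `L`,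
the window; the Schur constant of `B4Lemma22ZeroLatticeLpSchur.GkLat_apply_lp_le_of_lp`, free of `p₁`) such that for every
`k ≥ 1`, literal coefficient `a ∈ [a₋,a₊]`, mass `m² ∈ ]0,m²₊]`, real `p ≥ 1` and EVERY summable `f : ℤ^{d+1} → ℂ`:
`x ↦ ‖(G_jf)(x)‖^p` is summable and `(Σ_x‖(G_jf)(x)‖^p)^{1/p} ≤ c₀(Σ_z‖f(z)‖^p)^{1/p}` — «The Riesz-Thorin Theorem implies it
for arbitrary q = p from [1, ∞]», for «the propagator G_j with free boundary conditions on ξZ^d» of p. 584.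
[cite: Balaban1983RegularityDecay, Lemma 2.2 (2.17) p.578; proof p.583; (2.44)–(2.46) p.584; dictionary (□ ↦ ξℤ^{d+1}, A = 0, m² > 0, f ∈ ℓ¹)] -/
theorem G246_apply_lp_le_of_summable (d ℓ : ℕ) (hℓ : 1 ≤ ℓ) (amin aplus m2plus : ℝ) (ha : 0 < amin) :
    ∃ c₀ : ℝ, 0 < c₀ ∧ ∀ (k : ℕ), 1 ≤ k → ∀ (a m2 : ℝ), amin ≤ a → a ≤ aplus → 0 < m2 → m2 ≤ m2plus →
      ∀ (p : ℝ), 1 ≤ p → ∀ (f : (Fin (d + 1) → ℤ) → ℂ), (Summable fun z => ‖f z‖) →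
        (Summable fun x => ‖G246 ((ℓ + 1) ^ k) a m2 f x‖ ^ p) ∧
        (∑' x, ‖G246 ((ℓ + 1) ^ k) a m2 f x‖ ^ p) ^ p⁻¹ ≤ c₀ * (∑' z, ‖f z‖ ^ p) ^ p⁻¹ := by
  obtain ⟨c₀, hc₀, h⟩ := GkLat_apply_lp_le_of_lp d ℓ hℓ amin (aplus / (1 - ((((ℓ : ℝ) + 1)) ^ 2)⁻¹)) m2plus ha
  refine ⟨c₀, hc₀, fun k hk a m2 h1 h2 h3 h4 p hp f hf => ?_⟩
  obtain ⟨-, hA1, hA2⟩ := window_div_cK hℓ hk ha h1 h2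
  obtain ⟨-, hS, hB⟩ := h k hk (a / cK ℓ k) m2 hA1 hA2 h3.le h4 p hp f (summable_norm_rpow_of_summable_norm hf hp)
  have hpt : ∀ x, G246 ((ℓ + 1) ^ k) a m2 f x = ∑' z, ((GkLat ℓ k (a / cK ℓ k) m2 x z : ℝ) : ℂ) * f z :=
    fun x => G246_apply_eq_tsum hℓ hk (ha.trans_le h1) h3 hf x
  simp_rw [hpt]
  exact ⟨hS, hB⟩

/-- **LEMMA 2.2 (2.17) OFF THE DIAGONAL FOR `G_j`, REAL DATA** (`η`-weighted norms of (2.11), `η^{d+1} = n^{−(d+1)}`): there is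
`c₂ > 0` (on `d`, `L`, the window, `p₁`; the constant of `B4Lemma22ZeroLatticeLpOperators.GkLat_lpq_le_of_lp`) such that for
every `k ≥ 1`, `a ∈ [a₋,a₊]`, `m² ∈ ]0,m²₊]`, exponents `s = 1/p`, `t = 1/q` with `0 < t ≤ s ≤ 1`, `s − 1/p₁ ≤ t`
(`1 ≤ p ≤ q < ∞`, `1/p − 1/p₁ ≤ 1/q`, `p₁ > d + 1`) and EVERY summable real `f`: `x ↦ |(G_jf)(x)|^{1/t}` is summable and
`(η^{d+1}Σ_x|(G_jf)(x)|^{1/t})^t ≤ c₂(η^{d+1}Σ_z|f(z)|^{1/s})^s` — `‖G_jf‖_q ≤ c₂‖f‖_p`.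
[cite: Balaban1983RegularityDecay, Lemma 2.2 (2.17) p.578; proof p.583; (2.44)–(2.46) p.584; dictionary (□ ↦ ξℤ^{d+1}, A = 0, m² > 0, real f ∈ ℓ¹, p₁ > d+1)] -/
theorem G246_lpq_le_of_summable_real (d ℓ : ℕ) (hℓ : 1 ≤ ℓ) (amin aplus m2plus : ℝ) (ha : 0 < amin) (p₁ : ℝ)
    (hp : (d : ℝ) + 1 < p₁) :
    ∃ c₂ : ℝ, 0 < c₂ ∧ ∀ (k : ℕ), 1 ≤ k → ∀ (a m2 : ℝ), amin ≤ a → a ≤ aplus → 0 < m2 → m2 ≤ m2plus →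
      ∀ (s t : ℝ), 0 < t → t ≤ s → s ≤ 1 → s - 1 / p₁ ≤ t →
        ∀ (f : (Fin (d + 1) → ℤ) → ℝ), (Summable fun z => |f z|) →
          (Summable fun x => ‖G246 ((ℓ + 1) ^ k) a m2 (fun z => (f z : ℂ)) x‖ ^ (1 / t)) ∧
          (((1 : ℝ) / ((ℓ + 1) ^ k : ℕ)) ^ (d + 1) * ∑' x, ‖G246 ((ℓ + 1) ^ k) a m2 (fun z => (f z : ℂ)) x‖ ^ (1 / t)) ^ t
            ≤ c₂ * (((1 : ℝ) / ((ℓ + 1) ^ k : ℕ)) ^ (d + 1) * ∑' z, |f z| ^ (1 / s)) ^ s := by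
  obtain ⟨c₂, hc₂, h⟩ := GkLat_lpq_le_of_lp d ℓ hℓ amin (aplus / (1 - ((((ℓ : ℝ) + 1)) ^ 2)⁻¹)) m2plus ha p₁ hp
  refine ⟨c₂, hc₂, fun k hk a m2 h1 h2 h3 h4 s t ht hts hs1 hst f hf => ?_⟩
  obtain ⟨-, hA1, hA2⟩ := window_div_cK hℓ hk ha h1 h2
  have hs : 0 < s := ht.trans_le hts
  have hf' : Summable fun z => |f z| ^ (1 / s) := by
    have H := summable_norm_rpow_of_summable_norm (E := ℝ) (hf.congr fun z => (Real.norm_eq_abs _).symm)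
      (one_le_one_div hs hs1)
    exact H.congr fun z => by rw [Real.norm_eq_abs]
  obtain ⟨-, hS, hB⟩ := h k hk (a / cK ℓ k) m2 hA1 hA2 h3.le h4 s t ht hts hs1 hst f hf'
  simp_rw [norm_G246_apply_real hℓ hk (ha.trans_le h1) h3 hf]
  exact ⟨hS, hB⟩

/-- **(2.41) FOR `G_j`, REAL DATA** (`q = ∞`, `p ≥ p₁ > d + 1`): there is `c₂ > 0` (the constant of
`B4Lemma22ZeroLatticeLpOperators.GkLat_sup_lp_le_of_lp`) such that for every `k ≥ 1`, `a ∈ [a₋,a₊]`, `m² ∈ ]0,m²₊]`,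
`0 < s ≤ 1/p₁`, EVERY summable real `f` and every `x`: `|(G_jf)(x)| ≤ c₂(η^{d+1}Σ_z|f(z)|^{1/s})^s` — «bounded operators from
L^{p₁}(□) with p₁ > d to L^∞(□)».
[cite: Balaban1983RegularityDecay, (2.41) p.583 with Lemma 2.2 (2.17) p.578; (2.46) p.584; dictionary (□ ↦ ξℤ^{d+1}, A = 0, m² > 0, real f ∈ ℓ¹, p₁ > d+1)] -/
theorem G246_sup_lp_le_of_summable_real (d ℓ : ℕ) (hℓ : 1 ≤ ℓ) (amin aplus m2plus : ℝ) (ha : 0 < amin) (p₁ : ℝ)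
    (hp : (d : ℝ) + 1 < p₁) :
    ∃ c₂ : ℝ, 0 < c₂ ∧ ∀ (k : ℕ), 1 ≤ k → ∀ (a m2 : ℝ), amin ≤ a → a ≤ aplus → 0 < m2 → m2 ≤ m2plus →
      ∀ (s : ℝ), 0 < s → s ≤ 1 / p₁ → ∀ (f : (Fin (d + 1) → ℤ) → ℝ), (Summable fun z => |f z|) →
        ∀ (x : Fin (d + 1) → ℤ),
          ‖G246 ((ℓ + 1) ^ k) a m2 (fun z => (f z : ℂ)) x‖
            ≤ c₂ * (((1 : ℝ) / ((ℓ + 1) ^ k : ℕ)) ^ (d + 1) * ∑' z, |f z| ^ (1 / s)) ^ s := by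
  obtain ⟨c₂, hc₂, h⟩ := GkLat_sup_lp_le_of_lp d ℓ hℓ amin (aplus / (1 - ((((ℓ : ℝ) + 1)) ^ 2)⁻¹)) m2plus ha p₁ hp
  refine ⟨c₂, hc₂, fun k hk a m2 h1 h2 h3 h4 s hs hsp f hf x => ?_⟩
  obtain ⟨-, hA1, hA2⟩ := window_div_cK hℓ hk ha h1 h2
  have hD : (0 : ℝ) < (d : ℝ) + 1 := by positivity
  have hs1 : s ≤ 1 := hsp.trans (by rw [div_le_one (hD.trans hp)]; linarith)
  have hf' : Summable fun z => |f z| ^ (1 / s) := by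
    have H := summable_norm_rpow_of_summable_norm (E := ℝ) (hf.congr fun z => (Real.norm_eq_abs _).symm)
      (one_le_one_div hs hs1)
    exact H.congr fun z => by rw [Real.norm_eq_abs]
  rw [norm_G246_apply_real hℓ hk (ha.trans_le h1) h3 hf]
  exact (h k hk (a / cK ℓ k) m2 hA1 hA2 h3.le h4 s hs hsp f hf' x).2

/-! ## §3 Non-vacuity (`d + 1 = 4`, `L = 2`, `k = 1`, `a = 1`, `m² = 1`) -/

/-- the identification `G_k(0)f = G_jf` for a summable datum of INFINITE support (outside the scope of
`B4Thm110ZeroLattice.GkLat_apply_eq_G246`): `f(x) = i·2^{−|x₀|}` on the axis `x₁ = x₂ = x₃ = 0`, zero elsewhere. -/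
example : let f : (Fin (3 + 1) → ℤ) → ℂ :=
      fun x => if (∀ i, i ≠ 0 → x i = 0) then Complex.I * (((2 : ℝ)⁻¹ ^ (x 0).natAbs : ℝ) : ℂ) else 0
    (Summable fun z => ‖f z‖) ∧ ¬ (Function.support f).Finite ∧
    (fun x => ∑' z, ((GkLat 1 1 (1 / cK 1 1) 1 x z : ℝ) : ℂ) * f z) = G246 ((1 + 1) ^ 1) 1 1 f := by
  intro f
  set e : ℤ → (Fin (3 + 1) → ℤ) := fun n => Pi.single 0 n with he
  have he0 : ∀ n, e n 0 = n := fun n => by simp [he]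
  have hei : ∀ n (i : Fin (3 + 1)), i ≠ 0 → e n i = 0 := fun n i hi => by simp [he, Pi.single_eq_of_ne hi]
  have he_inj : Function.Injective e := fun m n h => by
    have := congrFun h 0
    rwa [he0, he0] at this
  have hfe : ∀ n, f (e n) = Complex.I * (((2 : ℝ)⁻¹ ^ n.natAbs : ℝ) : ℂ) := fun n => by
    simp only [f, if_pos (hei n), he0]
  have hnorm : ∀ n, ‖f (e n)‖ = (2 : ℝ)⁻¹ ^ n.natAbs := fun n => by
    rw [hfe, norm_mul, Complex.norm_I, one_mul, Complex.norm_real, Real.norm_eq_abs, abs_of_nonneg (by positivity)]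
  have hout : ∀ x ∉ Set.range e, f x = 0 := by
    intro x hx
    by_cases hc : ∀ i : Fin (3 + 1), i ≠ 0 → x i = 0
    · refine absurd ⟨x 0, ?_⟩ hx
      ext i
      by_cases hi : i = 0
      · subst hi; exact he0 _
      · rw [hei _ i hi, hc i hi]
    · simp only [f, if_neg hc]
  -- `Σ_n 2^{−|n|}` over `ℤ`: two geometric series
  have hgeom : Summable fun n : ℕ => ((2 : ℝ)⁻¹) ^ n :=
    summable_geometric_of_lt_one (by norm_num) (by norm_num)
  have hZ : Summable fun n : ℤ => (2 : ℝ)⁻¹ ^ n.natAbs := by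
    refine summable_int_iff_summable_nat_and_neg.2 ⟨?_, ?_⟩
    · exact hgeom.congr fun n => by rw [Int.natAbs_natCast]
    · exact hgeom.congr fun n => by rw [Int.natAbs_neg, Int.natAbs_natCast]
  have hsum : Summable fun z => ‖f z‖ := by
    have hout' : ∀ x ∉ Set.range e, (fun z => ‖f z‖) x = 0 := fun x hx => by simp only [hout x hx, norm_zero]
    exact (he_inj.summable_iff hout').1 (hZ.congr fun n => by simp only [Function.comp_apply, hnorm])
  refine ⟨hsum, fun hfin => ?_, GkLat_apply_eq_G246_literal (d := 3) le_rfl le_rfl one_pos one_pos hsum⟩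
  have hsub : Set.range e ⊆ Function.support f := by
    rintro _ ⟨n, rfl⟩
    rw [Function.mem_support, ← norm_pos_iff, hnorm]
    positivity
  exact (Set.infinite_range_of_injective he_inj).mono hsub hfin

/-- the (2.17) diagonal for `G_j` at the physical dimension: the quantifier prefix is inhabited (`L = 2`, window
`[1/2, 2] × ]0, 1]`). -/
example : ∃ c₀ : ℝ, 0 < c₀ ∧ ∀ (k : ℕ), 1 ≤ k → ∀ (a m2 : ℝ), (1 / 2 : ℝ) ≤ a → a ≤ 2 → 0 < m2 → m2 ≤ 1 →
      ∀ (p : ℝ), 1 ≤ p → ∀ (f : (Fin (3 + 1) → ℤ) → ℂ), (Summable fun z => ‖f z‖) →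
        (Summable fun x => ‖G246 ((1 + 1) ^ k) a m2 f x‖ ^ p) ∧
        (∑' x, ‖G246 ((1 + 1) ^ k) a m2 f x‖ ^ p) ^ p⁻¹ ≤ c₀ * (∑' z, ‖f z‖ ^ p) ^ p⁻¹ :=
  G246_apply_lp_le_of_summable 3 1 le_rfl (1 / 2) 2 1 (by norm_num)

end

end Literature.MathematicalPhysics.QuantumFieldTheory.Balaban1983to89.B4Eq246ZeroLatticeL1
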